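/-
Copyright (c) 2026. All rights reserved.
Released under Apache 2.0 license as described in the file LICENSE.
-/
import Summits.HodgeConjecture.HodgeConjecture.Theorems.K2LiuArchInducedTubeSection      -- ★ (A∞-0) `det_denom_mul_of_siegel`, `det_toBlocks₂₂_of_mem_siegel`, `norm_det_denom_of_stab`
import Summits.HodgeConjecture.HodgeConjecture.Theorems.K2LiuArchFrameBridge             -- ★ S2-B `kappa_eq`, `denom_kappa_I`, `norm_det_eq_one_of_conjTranspose_mul_self`
import Summits.HodgeConjecture.HodgeConjecture.Theorems.K2LiuU22CompactPictureDefs       -- ★ S2-K `Carrier`, `evalAt` (the `cp F = Q` currency of ★ FILE 9 ∕ ★ (E8) END)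
import Literature.NumberTheory.Automorphic.MixedSpaceUnitsMellinProduct                   -- ★ `ofReal_prod_cpow`
import HarnessLib

/-!
# Crux `HLiu418`, G6-arch ASSEMBLY FILE 13 — (E8rec) DICTIONARY, brick (D-D): THE FLAT TWIST OF A TUBE SIEGEL SECTION
# `F ∈ I_w(s₀, χ) ⇒ (g ↦ ‖j(g, i1)‖^{2(s₀−s)} · F g) ∈ I_w(s, χ)` with the SAME compact picture (`‖j(κ(1,v), i1)‖ = ‖det v‖ = 1`)

Cell `hodgecm-mathlib`, crux item hLiu418 = `stmt-HodgeConjecture-24832` (helper lane `--supports`, count-neutral).  K2Liu-p11 (g4) (E8rec) dictionary census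
22:28Z, brick (D-D); consumer: the (β) END file (K2Liu-p13 (g4)) feeding ★ (E8) END `K2LiuArchBlockOfFrameEnd.exists_continuation_integral_unipDeltaArch` (K2Liu-p03),
whose sections must be FLAT: `F_{w,s} ∈ I_w(s, χ_{k_w})` with an `s`-INDEPENDENT compact picture `cp F_{w,s} = Q_w`.

WHY.  (E6′) ★ `K2LiuStdFamilyAwayPurityFlat.exists_awayPurity_flat` presents the arch factor of a standard family as `H_∞^{2(s−s₀)} · A_i` with `A_i` an arch Siegel section at
the FIXED parameter `s₀`; in the tube frame the height is `‖j(g, i1)‖⁻¹ = ‖det A_p‖` (`g = p·κ`, `κ ∈ Stab(i1)`), so the flat family at `s` is the (D-D) twist of the `s₀`-section.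
This file is the tube half of that dictionary, for ANY size `l` and ANY character `χ`:
* §1 **`isArchSiegelSection_flatTwist`** — the parabolic law at `s` of `g ↦ ‖j(g,i1)‖^{2(s₀−s)} · F g` for `F ∈ I_w(s₀, χ)` (`j(pg, i1) = det p₂₂ · j(g, i1)`, `det p₂₂ = (conj det p₁₁)⁻¹`
  on `U(J) ∩ P_Δ`: ★ `det_denom_mul_of_siegel`, ★ `det_toBlocks₂₂_of_mem_siegel`); `flatTwist_self` (at `s = s₀` the twist is `F` on `{j ≠ 0}`-free terms: factor `1`).
* §2 **the compact picture is unchanged**: `norm_det_denom_cayleyPoint` (`‖j(κ(1,v), i1)‖ = 1` for unitary `v`: ★ `kappa_eq`, ★ `denom_kappa_I`), `flatTwist_cayleyPoint`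
  (the twist factor is `1` at every Cayley point), **`flatTwist_compactPicture`** (`cp F = Q ⇒ cp (twist F) = Q` in ★ FILE 9's `evalAt` currency), and the stabiliser form
  `flatTwist_mul_stab`-free statement `norm_det_denom_eq_one_of_stab` re-exported for `u ∈ Stab(i1)` (★ `norm_det_denom_of_stab`).
* §3 **products over places**: `prod_flatTwist` — `∏_w ‖j(g_w,i1)‖^{2(s₀−s)} F_w(g_w) = (∏_w ‖j(g_w,i1)‖)^{2(s₀−s)} · ∏_w F_w(g_w)` (★ `ofReal_prod_cpow`) — the shape in which the
  group-side height `H_∞ = ∏_w ‖j(Fr · w, i1)‖⁻¹` (brick (D-C′)) multiplies a place-pure product.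
References: [Shimura1997, §16.4 (the scalar sections `j^{−k}|j|^{k−2s−l}`), §5.2 (the cocycle)]; [KudlaRallis1994, §1 (flat = standard sections)]; [Tan1999, §1].
HONEST LABEL: HC_CM is proved only modulo the 7 printed citations (2 remaining named inputs: hLiu418 = stmt-HodgeConjecture-24832,
h413 = stmt-HodgeConjecture-24833) until rung 0 closes; count-neutral helper, closes no socket.
-/

set_option autoImplicit false
set_option linter.dupNamespace false

noncomputable section

open scoped Matrix ComplexConjugate
open Complex Matrix
open Literature.NumberTheory.ModularForms.SiegelUpperHalfSpace (denom moeb)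
open Literature.NumberTheory.Automorphic (ofReal_prod_cpow)

namespace Summit.HodgeConjecture.HodgeConjecture.Cruxes.HLiu418.K2LiuArchSectionFlatTwist

open K2LiuArchInducedTubeDefs K2LiuArchInducedTubeSectionPrelims K2LiuArchFrameBridge K2LiuU22CompactPictureDefs

variable {l : Type*} [Fintype l] [DecidableEq l]

/-! ## §1  The flat twist obeys the parabolic law at `s` -/

/-- **THE FLAT TWIST IS A SECTION AT `s`**: if `F ∈ I_w(s₀, χ)` (★ `IsArchSiegelSection χ s₀ F`) then `g ↦ ‖j(g, i1)‖^{2(s₀−s)} · F g` lies in `I_w(s, χ)` — for `p ∈ U(J) ∩ P_Δ`,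
`‖j(pg, i1)‖ = ‖det p₁₁‖⁻¹ · ‖j(g, i1)‖`, and `‖det p₁₁‖^{−2(s₀−s)} · ‖det p₁₁‖^{2s₀+l} = ‖det p₁₁‖^{2s+l}`. [Shimura1997, §16.4] [KudlaRallis1994, §1] -/
theorem isArchSiegelSection_flatTwist {χ : ℂ → ℂ} {s₀ : ℂ} {F : Matrix (l ⊕ l) (l ⊕ l) ℂ → ℂ} (hF : IsArchSiegelSection χ s₀ F) (s : ℂ) :
    IsArchSiegelSection χ s (fun g => (((‖(denom g (I • (1 : Matrix l l ℂ))).det‖ : ℝ) : ℂ) ^ (2 * (s₀ - s))) * F g) := by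
  intro p g hP hp
  obtain ⟨hne, h22⟩ := det_toBlocks₂₂_of_mem_siegel hP hp
  have hn0 : ((‖p.toBlocks₁₁.det‖ : ℝ) : ℂ) ≠ 0 := by exact_mod_cast (norm_ne_zero_iff.2 hne)
  have hnpos : (0 : ℝ) < ‖p.toBlocks₁₁.det‖ := norm_pos_iff.2 hne
  have harg : (((‖p.toBlocks₁₁.det‖ : ℝ) : ℂ)).arg ≠ Real.pi := by
    rw [Complex.arg_ofReal_of_nonneg hnpos.le]; exact Real.pi_ne_zero.symm
  simp only
  rw [hF p g hP hp, det_denom_mul_of_siegel hp, h22, norm_mul, norm_inv, Complex.norm_conj, Complex.ofReal_mul,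
    Complex.mul_cpow_ofReal_nonneg (inv_nonneg.2 (norm_nonneg _)) (norm_nonneg _), Complex.ofReal_inv, Complex.inv_cpow _ _ harg,
    ← Complex.cpow_neg]
  -- `‖d‖^{−2(s₀−s)} · ‖d‖^{2s₀+l} = ‖d‖^{2s+l}`
  have hexp : ((‖p.toBlocks₁₁.det‖ : ℝ) : ℂ) ^ (-(2 * (s₀ - s))) * ((‖p.toBlocks₁₁.det‖ : ℝ) : ℂ) ^ (2 * s₀ + (Fintype.card l : ℂ)) =
      ((‖p.toBlocks₁₁.det‖ : ℝ) : ℂ) ^ (2 * s + (Fintype.card l : ℂ)) := by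
    rw [← Complex.cpow_add _ _ hn0]
    congr 1
    ring
  rw [← hexp]
  ring

/-- at `s = s₀` the twist factor is `1` whenever `j(g, i1) ≠ 0` (e.g. on `U(J)`): the twisted section IS `F` there. [Shimura1997, §16.4] -/
theorem flatTwist_self (s₀ : ℂ) (F : Matrix (l ⊕ l) (l ⊕ l) ℂ → ℂ) (g : Matrix (l ⊕ l) (l ⊕ l) ℂ) :
    (((‖(denom g (I • (1 : Matrix l l ℂ))).det‖ : ℝ) : ℂ) ^ (2 * (s₀ - s₀))) * F g = F g := by
  rw [sub_self, mul_zero, Complex.cpow_zero, one_mul]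

/-! ## §2  The compact picture is unchanged -/

/-- **`‖j(κ(1,v), i1)‖ = 1`** at the Cayley point of a unitary `v` (`j(κ(1,v), i1) = v`, ★ `kappa_eq` + ★ `denom_kappa_I`; `‖det v‖ = 1`). [Shimura1997, §6.5] -/
theorem norm_det_denom_cayleyPoint {v : Matrix l l ℂ} (hv : vᴴ * v = 1) :
    ‖(denom ((2 : ℂ)⁻¹ • fromBlocks (1 + v) (-(I • (1 - v))) (I • (1 - v)) (1 + v) : Matrix (l ⊕ l) (l ⊕ l) ℂ) (I • (1 : Matrix l l ℂ))).det‖ = 1 := by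
  rw [← kappa_eq, denom_kappa_I]
  exact norm_det_eq_one_of_conjTranspose_mul_self hv

/-- **the twist factor is `1` at every Cayley point**: `(twist F)(κ(1,v)) = F(κ(1,v))` for unitary `v`. [Shimura1997, §6.5, §16.4] -/
theorem flatTwist_cayleyPoint (s₀ s : ℂ) (F : Matrix (l ⊕ l) (l ⊕ l) ℂ → ℂ) {v : Matrix l l ℂ} (hv : vᴴ * v = 1) :
    (((‖(denom ((2 : ℂ)⁻¹ • fromBlocks (1 + v) (-(I • (1 - v))) (I • (1 - v)) (1 + v) : Matrix (l ⊕ l) (l ⊕ l) ℂ) (I • (1 : Matrix l l ℂ))).det‖ : ℝ) : ℂ) ^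
          (2 * (s₀ - s))) *
        F ((2 : ℂ)⁻¹ • fromBlocks (1 + v) (-(I • (1 - v))) (I • (1 - v)) (1 + v)) =
      F ((2 : ℂ)⁻¹ • fromBlocks (1 + v) (-(I • (1 - v))) (I • (1 - v)) (1 + v)) := by
  rw [norm_det_denom_cayleyPoint hv, Complex.ofReal_one, Complex.one_cpow, one_mul]

/-- **THE COMPACT PICTURE OF THE FLAT TWIST IS THAT OF `F`** (★ FILE 9 ∕ ★ (E8) END currency `cp F = Q`, `Q : Carrier`, size `2`). [Shimura1997, §16.4] [LeeZhu1998, §5] -/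
theorem flatTwist_compactPicture (s₀ s : ℂ) {F : Matrix (Fin 2 ⊕ Fin 2) (Fin 2 ⊕ Fin 2) ℂ → ℂ} {Q : Carrier}
    (hQ : ∀ (v : Matrix (Fin 2) (Fin 2) ℂ), vᴴ * v = 1 → ∀ hv : v.det ≠ 0,
      F ((2 : ℂ)⁻¹ • fromBlocks (1 + v) (-(I • (1 - v))) (I • (1 - v)) (1 + v) : Matrix (Fin 2 ⊕ Fin 2) (Fin 2 ⊕ Fin 2) ℂ) = evalAt v hv Q) :
    ∀ (v : Matrix (Fin 2) (Fin 2) ℂ), vᴴ * v = 1 → ∀ hv : v.det ≠ 0,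
      (fun g : Matrix (Fin 2 ⊕ Fin 2) (Fin 2 ⊕ Fin 2) ℂ => (((‖(denom g (I • (1 : Matrix (Fin 2) (Fin 2) ℂ))).det‖ : ℝ) : ℂ) ^ (2 * (s₀ - s))) * F g)
        ((2 : ℂ)⁻¹ • fromBlocks (1 + v) (-(I • (1 - v))) (I • (1 - v)) (1 + v) : Matrix (Fin 2 ⊕ Fin 2) (Fin 2 ⊕ Fin 2) ℂ) = evalAt v hv Q := by
  intro v hv hdet
  simp only
  rw [flatTwist_cayleyPoint s₀ s F hv, hQ v hv hdet]

/-- the twist factor is `1` on the whole stabiliser `Stab(i1) ⊆ U(J)` (★ `norm_det_denom_of_stab`): `(twist F)(u) = F u`. [Shimura1997, §6.5] -/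
theorem flatTwist_stab (s₀ s : ℂ) (F : Matrix (l ⊕ l) (l ⊕ l) ℂ → ℂ) {u : Matrix (l ⊕ l) (l ⊕ l) ℂ} (hU : uᴴ * Matrix.J l ℂ * u = Matrix.J l ℂ)
    (hI : moeb u (I • (1 : Matrix l l ℂ)) = I • 1) :
    (((‖(denom u (I • (1 : Matrix l l ℂ))).det‖ : ℝ) : ℂ) ^ (2 * (s₀ - s))) * F u = F u := by
  rw [norm_det_denom_of_stab hU hI, Complex.ofReal_one, Complex.one_cpow, one_mul]

/-- **right `Stab(i1)`-equivariance of the twist factor**: `‖j(g u, i1)‖ = ‖j(g, i1)‖` for `g ∈ U(J)`, `u ∈ Stab(i1)` — so the twist commutes with the right `K_w`-action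
(the `K_w`-span of the twisted section is the twist of the `K_w`-span). [Shimura1997, §6.5] -/
theorem norm_det_denom_mul_stab {g u : Matrix (l ⊕ l) (l ⊕ l) ℂ} (hg : gᴴ * Matrix.J l ℂ * g = Matrix.J l ℂ)
    (hU : uᴴ * Matrix.J l ℂ * u = Matrix.J l ℂ) (hI : moeb u (I • (1 : Matrix l l ℂ)) = I • 1) :
    ‖(denom (g * u) (I • (1 : Matrix l l ℂ))).det‖ = ‖(denom g (I • (1 : Matrix l l ℂ))).det‖ := by
  have _ := hg
  rw [K2LiuHermitianTubeCocycle.det_denom_mul_of_posDef hU K2LiuHermitianTubeCocycle.posDef_im_I_smul_one, hI, norm_mul,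
    norm_det_denom_of_stab hU hI, mul_one]

/-! ## §3  Products over places -/

/-- **PRODUCTS OVER PLACES**: `∏_w ‖j(g_w, i1)‖^{2(s₀−s)} · F_w(g_w) = (∏_w ‖j(g_w, i1)‖)^{2(s₀−s)} · ∏_w F_w(g_w)` (★ `ofReal_prod_cpow`) — a place-pure product of
flat twists is the global height factor times the place-pure product. [KudlaRallis1994, §1] [Tan1999, §1] -/
theorem prod_flatTwist {σ : Type*} [Fintype σ] (s₀ s : ℂ) (F : σ → Matrix (l ⊕ l) (l ⊕ l) ℂ → ℂ) (g : σ → Matrix (l ⊕ l) (l ⊕ l) ℂ) :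
    ∏ w, (((‖(denom (g w) (I • (1 : Matrix l l ℂ))).det‖ : ℝ) : ℂ) ^ (2 * (s₀ - s))) * F w (g w) =
      (((∏ w, ‖(denom (g w) (I • (1 : Matrix l l ℂ))).det‖ : ℝ)) : ℂ) ^ (2 * (s₀ - s)) * ∏ w, F w (g w) := by
  rw [Finset.prod_mul_distrib, ofReal_prod_cpow _ _ (fun w _ => norm_nonneg _)]

end Summit.HodgeConjecture.HodgeConjecture.Cruxes.HLiu418.K2LiuArchSectionFlatTwist

end
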